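import Summits.CriticalPhenomena.PercolationContinuityZ3.Theorems.PercNearOneGluingNoHeavyLowerTailSahiCombTriWCone

/-!
# AND-products `P₁ ∧ Q` over disjoint blocks: the sectionwise Formula-A score, its upper bound (proved), and the typed lower-bound conjecture

Support file of the one-cut programme (crux `NoHeavyLowerTail`, stmt-CriticalPhenomena-4575; unit `prim-lf-1` gen 41, memo
`FROM-prim-lf-1-gen41-SHELLS-AND-OR-PRODUCTS.md` §7).  Continuation of the CONE THEOREM (`…SahiCombTriWCone`, the case `P₁ = {univ}`).

For `P₁ ⊆ Finset γ₁` and `Q ⊆ Finset γ₂` the AND-product is `andProd P₁ Q = {t | t.toLeft ∈ P₁ ∧ t.toRight ∈ Q}`.  The SECTIONWISE FORMULA-A score puts, on a point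
`x ⊔ y` of the product with `x ∈ P₁`, `y ∈ Q`: `[x ⊔ yᶜ ∈ A]` if `y ∈ Q ∩ refl Q`, `[x ⊔ y ∈ A]` if `y ∈ Q \ refl Q` — Formula A of `Q` on every fibre of `P₁`
(`FiveUpSet.secFAScore`; for `P₁ = {univ}` it is the cone score).
* `uForm_andProd`, `scoreVal_secFAScore`, **`scoreVal_secFAScore_le_uForm`** — the UPPER sandwich bound holds for EVERY up-set `P₁` and every up-set `Q`
  (Formula A's upper bound fibrewise + Kleitman `#(P₁ ∩ C) ≥ #(P₁ ∩ refl C)` on the sections of `A ∩ B`).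
* **`FiveUpSet.AndShellLower`** (`@[conjecture]`, typed): if `P₁` is an antipode-free up-set with a Kleitman shell and `Q` an up-set with a Kleitman shell, the LOWER bound
  `L_{andProd P₁ Q}(A,B) ≤ Σ_B secFAScore` holds for all up-sets `A, B`.  EVIDENCE (exact, P5 oracle, all pairs): `maj₃ ∧ OR₂` (n=5), `maj₃ ∧ OR₃`, `maj₃ ∧ (x ∨ yz)`, `maj₃ ∧ maj₃` (n=6),
  every cone; n = 7, 8 principal-exhaustive + random probes of `Cor_{P₁×P₂} ≥ 0` for intersecting shells (memo §7); it FAILS when `P₁` is not a shell (`K₂₂`, `x₀(x₁∨x₂) ∧ OR₃`), so the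
  hypotheses are sharp on that side.  PROVED CASE: `P₁ = {univ}` (`scoreCert_coneScore`).
* **`triW_nonneg_andProd_of_andShellLower`** — the conjecture implies `TriWIneq` for all such AND-products (hence for `maj·maj`, `maj·(x∨yz)`, (⋀ of intersecting shells) ∧ shell, …).
HONEST LABEL: the upper half and the reduction are proved (std axioms); the lower half is an OPEN typed conjecture, never used as a fact. [this work]
-/

namespace Summit.CriticalPhenomena.PercolationContinuityZ3.Theorems

namespace FiveUpSet

open Finset

variable {β γ₁ γ₂ : Type} [DecidableEq β] [Fintype β] [DecidableEq γ₁] [Fintype γ₁] [DecidableEq γ₂] [Fintype γ₂]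

/-- The AND-product of two families over disjoint blocks: `{t | t.toLeft ∈ P₁ ∧ t.toRight ∈ Q}`. [this work] -/
def andProd (P₁ : Finset (Finset γ₁)) (Q : Finset (Finset γ₂)) : Finset (Finset (γ₁ ⊕ γ₂)) :=
  univ.filter fun t => t.toLeft ∈ P₁ ∧ t.toRight ∈ Q

omit [DecidableEq β] [Fintype β] in
/-- Membership in the AND-product. [this work] -/
@[simp] theorem mem_andProd {P₁ : Finset (Finset γ₁)} {Q : Finset (Finset γ₂)} {t : Finset (γ₁ ⊕ γ₂)} :
    t ∈ andProd P₁ Q ↔ t.toLeft ∈ P₁ ∧ t.toRight ∈ Q := by simp [andProd]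

omit [DecidableEq β] [Fintype β] in
/-- The AND-product of up-sets is an up-set. [this work] -/
theorem isUpperSet_andProd {P₁ : Finset (Finset γ₁)} {Q : Finset (Finset γ₂)} (h₁ : IsUpperSet (P₁ : Set (Finset γ₁)))
    (hQ : IsUpperSet (Q : Set (Finset γ₂))) : IsUpperSet (andProd P₁ Q : Set (Finset (γ₁ ⊕ γ₂))) := by
  intro t t' htt' ht
  rw [mem_coe, mem_andProd] at ht ⊢
  exact ⟨h₁ (toLeft_subset_toLeft htt') ht.1, hQ (toRight_subset_toRight htt') ht.2⟩

omit [DecidableEq β] [Fintype β] in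
/-- The AND-product as a union of rows. [this work] -/
theorem andProd_eq_biUnion (P₁ : Finset (Finset γ₁)) (Q : Finset (Finset γ₂)) :
    andProd P₁ Q = P₁.biUnion fun x => Q.map (rowEmb x) := by
  ext t
  rw [mem_andProd, mem_biUnion]
  constructor
  · rintro ⟨h1, h2⟩
    exact ⟨t.toLeft, h1, mem_map.2 ⟨t.toRight, h2, by rw [rowEmb_apply, eq_comm, eq_disjSum_iff]; exact ⟨rfl, rfl⟩⟩⟩
  · rintro ⟨x, hx, ht⟩
    rw [mem_map] at ht
    obtain ⟨y, hy, rfl⟩ := ht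
    rw [rowEmb_apply, toLeft_disjSum, toRight_disjSum]
    exact ⟨hx, hy⟩

omit [DecidableEq β] [Fintype β] [DecidableEq γ₁] [Fintype γ₁] [DecidableEq γ₂] [Fintype γ₂] in
/-- Rows at different first coordinates are disjoint. [this work] -/
theorem pairwiseDisjoint_rows (P₁ : Finset (Finset γ₁)) (Q : Finset (Finset γ₂)) :
    (P₁ : Set (Finset γ₁)).PairwiseDisjoint fun x => Q.map (rowEmb x) := by
  intro x _ x' _ hne
  rw [Function.onFun, disjoint_left]
  intro t ht ht'
  rw [mem_map] at ht ht'
  obtain ⟨y, _, rfl⟩ := ht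
  obtain ⟨y', _, h⟩ := ht'
  exact hne (by simpa using (congrArg Finset.toLeft h).symm)

omit [DecidableEq β] [Fintype β] in
/-- Counting points of the AND-product inside two families, row by row. [this work] -/
theorem card_andProd_inter_inter (P₁ : Finset (Finset γ₁)) (Q : Finset (Finset γ₂)) (A B : Finset (Finset (γ₁ ⊕ γ₂))) :
    ((andProd P₁ Q ∩ A ∩ B).card : ℤ) = ∑ x ∈ P₁, ((Q ∩ secR A x ∩ secR B x).card : ℤ) := by
  rw [andProd_eq_biUnion, biUnion_inter, biUnion_inter, card_biUnion]
  · push_cast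
    exact sum_congr rfl fun x _ => by rw [card_map_rowEmb_inter_inter]
  · intro x hx x' hx' hne
    rw [Function.onFun]
    exact disjoint_of_subset_left (inter_subset_left.trans inter_subset_left)
      (disjoint_of_subset_right (inter_subset_left.trans inter_subset_left) (pairwiseDisjoint_rows P₁ Q hx hx' hne))

omit [DecidableEq β] [Fintype β] in
/-- The antipodal image of an AND-product is the AND-product of the antipodal images. [this work] -/
theorem refl_andProd (P₁ : Finset (Finset γ₁)) (Q : Finset (Finset γ₂)) : refl (andProd P₁ Q) = andProd (refl P₁) (refl Q) := by
  ext t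
  rw [mem_refl, mem_andProd, mem_andProd, mem_refl, mem_refl, toLeft_compl, toRight_compl]

omit [DecidableEq β] [Fintype β] in
/-- **Upper form of the AND-product**: `U(A,B) = Σ_{x∈P₁} 2#(Q∩A_x∩B_x) − Σ_{x∈refl P₁} #(refl Q∩A_x∩B_x)`. [this work] -/
theorem uForm_andProd (P₁ : Finset (Finset γ₁)) (Q : Finset (Finset γ₂)) (A B : Finset (Finset (γ₁ ⊕ γ₂))) :
    uForm (andProd P₁ Q) A B
      = 2 * ∑ x ∈ P₁, ((Q ∩ secR A x ∩ secR B x).card : ℤ) - ∑ x ∈ refl P₁, ((refl Q ∩ secR A x ∩ secR B x).card : ℤ) := by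
  unfold uForm
  rw [card_andProd_inter_inter, refl_andProd, card_andProd_inter_inter]

/-! ### The sectionwise Formula-A score -/

/-- The sectionwise Formula-A score of `P₁ ∧ Q`: Formula A of `Q` on every fibre `x ∈ P₁`. [this work] -/
def secFAScore (P₁ : Finset (Finset γ₁)) (Q : Finset (Finset γ₂)) (A : Finset (Finset (γ₁ ⊕ γ₂))) (t : Finset (γ₁ ⊕ γ₂)) : ℕ :=
  if t.toLeft ∈ P₁ ∧ t.toRight ∈ Q then
    (if t.toRightᶜ ∈ Q then (if t.toLeft.disjSum t.toRightᶜ ∈ A then 1 else 0) else (if t ∈ A then 1 else 0))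
  else 0

omit [DecidableEq β] [Fintype β] [Fintype γ₁] in
/-- The sectionwise score is monotone in the family. [this work] -/
theorem monoScore_secFAScore (P₁ : Finset (Finset γ₁)) (Q : Finset (Finset γ₂)) : MonoScore (secFAScore P₁ Q) := by
  intro A A' hAA' t
  unfold secFAScore
  by_cases h1 : t.toLeft ∈ P₁ ∧ t.toRight ∈ Q
  · rw [if_pos h1, if_pos h1]
    by_cases h2 : t.toRightᶜ ∈ Q
    · rw [if_pos h2, if_pos h2]
      by_cases h3 : t.toLeft.disjSum t.toRightᶜ ∈ A
      · rw [if_pos h3, if_pos (hAA' h3)]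
      · rw [if_neg h3]; exact Nat.zero_le _
    · rw [if_neg h2, if_neg h2]
      by_cases h3 : t ∈ A
      · rw [if_pos h3, if_pos (hAA' h3)]
      · rw [if_neg h3]; exact Nat.zero_le _
  · rw [if_neg h1, if_neg h1]

omit [DecidableEq β] [Fintype β] in
/-- **Value of the sectionwise score**: `Σ_{t∈B} secFAScore = Σ_{x∈P₁} [#(Q ∩ refl Q ∩ B_x ∩ refl A_x) + #((Q \ refl Q) ∩ A_x ∩ B_x)]`. [this work] -/
theorem scoreVal_secFAScore (P₁ : Finset (Finset γ₁)) (Q : Finset (Finset γ₂)) (A B : Finset (Finset (γ₁ ⊕ γ₂))) :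
    scoreVal (secFAScore P₁ Q) A B
      = ∑ x ∈ P₁, (((Q ∩ refl Q ∩ secR B x ∩ refl (secR A x)).card : ℤ) + ((Q \ refl Q) ∩ secR A x ∩ secR B x).card) := by
  unfold scoreVal
  have hzero : ∀ t ∈ B, t ∉ andProd P₁ Q → (secFAScore P₁ Q A t : ℤ) = 0 := by
    intro t _ ht
    unfold secFAScore
    rw [if_neg (fun h => ht (mem_andProd.2 h))]
    simp
  rw [← Finset.sum_subset (inter_subset_left (s₁ := B) (s₂ := andProd P₁ Q))
    (fun t htB htn => hzero t htB (fun htR => htn (mem_inter.2 ⟨htB, htR⟩)))]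
  -- `B ∩ andProd = ⋃_x rows`
  have hre : B ∩ andProd P₁ Q = P₁.biUnion fun x => (Q ∩ secR B x).map (rowEmb x) := by
    ext t
    rw [mem_inter, mem_andProd, mem_biUnion]
    constructor
    · rintro ⟨hB, h1, h2⟩
      refine ⟨t.toLeft, h1, mem_map.2 ⟨t.toRight, mem_inter.2 ⟨h2, ?_⟩, ?_⟩⟩
      · rw [mem_secR, toLeft_disjSum_toRight]; exact hB
      · rw [rowEmb_apply, toLeft_disjSum_toRight]
    · rintro ⟨x, hx, ht⟩
      rw [mem_map] at ht
      obtain ⟨y, hy, rfl⟩ := ht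
      rw [mem_inter, mem_secR] at hy
      rw [rowEmb_apply, toLeft_disjSum, toRight_disjSum]
      exact ⟨hy.2, hx, hy.1⟩
  rw [hre, sum_biUnion]
  · refine sum_congr rfl fun x hx => ?_
    rw [sum_map]
    have hval : ∀ y ∈ Q ∩ secR B x, (secFAScore P₁ Q A (rowEmb x y) : ℤ)
        = (if y ∈ Q ∩ refl Q ∩ secR B x ∩ refl (secR A x) then 1 else 0)
          + (if y ∈ (Q \ refl Q) ∩ secR A x ∩ secR B x then 1 else 0) := by
      intro y hy
      rw [mem_inter] at hy
      unfold secFAScore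
      rw [rowEmb_apply, toLeft_disjSum, toRight_disjSum, if_pos ⟨hx, hy.1⟩]
      by_cases hc : yᶜ ∈ Q
      · rw [if_pos hc]
        have h2 : y ∉ (Q \ refl Q) ∩ secR A x ∩ secR B x := by
          intro h; simp only [mem_inter, mem_sdiff, mem_refl] at h; exact h.1.1.2 hc
        rw [if_neg h2, add_zero]
        by_cases h3 : x.disjSum yᶜ ∈ A
        · rw [if_pos h3, if_pos]; · simp
          simp only [mem_inter, mem_refl, mem_secR]; exact ⟨⟨⟨hy.1, hc⟩, mem_secR.1 hy.2⟩, h3⟩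
        · rw [if_neg h3, if_neg]; · simp
          simp only [mem_inter, mem_refl, mem_secR]; intro h; exact h3 h.2
      · rw [if_neg hc]
        have h2 : y ∉ Q ∩ refl Q ∩ secR B x ∩ refl (secR A x) := by
          intro h; simp only [mem_inter, mem_refl] at h; exact hc h.1.1.2
        rw [if_neg h2, zero_add]
        by_cases h3 : x.disjSum y ∈ A
        · rw [if_pos h3, if_pos]; · simp
          simp only [mem_inter, mem_sdiff, mem_refl, mem_secR]; exact ⟨⟨⟨hy.1, hc⟩, h3⟩, mem_secR.1 hy.2⟩
        · rw [if_neg h3, if_neg]; · simp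
          simp only [mem_inter, mem_sdiff, mem_refl, mem_secR]; intro h; exact h3 h.1.2
    rw [Finset.sum_congr rfl hval, sum_add_distrib, Finset.sum_boole, Finset.sum_boole]
    congr 1
    · congr 2
      ext y; simp only [mem_filter, mem_inter, mem_refl, mem_secR]; tauto
    · congr 2
      ext y; simp only [mem_filter, mem_inter, mem_refl, mem_secR, mem_sdiff]; tauto
  · intro x hx x' hx' hne
    rw [Function.onFun]
    exact disjoint_of_subset_left (map_subset_map.2 inter_subset_left)
      (disjoint_of_subset_right (map_subset_map.2 inter_subset_left) (pairwiseDisjoint_rows P₁ Q hx hx' hne))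

omit [DecidableEq β] [Fintype β] in
/-- **The UPPER sandwich bound of the sectionwise score, for every up-set `P₁` and every up-set `Q`.** [this work] -/
theorem scoreVal_secFAScore_le_uForm {P₁ : Finset (Finset γ₁)} {Q : Finset (Finset γ₂)} (h₁ : IsUpperSet (P₁ : Set (Finset γ₁)))
    (hQ : IsUpperSet (Q : Set (Finset γ₂))) {A B : Finset (Finset (γ₁ ⊕ γ₂))}
    (hA : IsUpperSet (A : Set (Finset (γ₁ ⊕ γ₂)))) (hB : IsUpperSet (B : Set (Finset (γ₁ ⊕ γ₂)))) :
    scoreVal (secFAScore P₁ Q) A B ≤ uForm (andProd P₁ Q) A B := by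
  rw [scoreVal_secFAScore, uForm_andProd]
  -- fibrewise Formula A: `#(S∩B_x∩refl A_x) + #(E∩A_x∩B_x) ≤ 2#(Q∩A_x∩B_x) − #(refl Q∩A_x∩B_x)`
  have hfib : ∀ x : Finset γ₁, (((Q ∩ refl Q ∩ secR B x ∩ refl (secR A x)).card : ℤ) + ((Q \ refl Q) ∩ secR A x ∩ secR B x).card)
      ≤ 2 * ((Q ∩ secR A x ∩ secR B x).card : ℤ) - (refl Q ∩ secR A x ∩ secR B x).card := by
    intro x
    have hk : ((Q ∩ refl Q ∩ secR B x ∩ refl (secR A x)).card : ℤ) + ((Q \ refl Q) ∩ secR A x ∩ secR B x).card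
        = ptVal (kapA Q) (secR B x) (secR A x) := by
      rw [ptVal_kapA, show (Q \ refl Q) ∩ secR A x ∩ secR B x = (Q \ refl Q) ∩ secR B x ∩ secR A x by
        ext y; simp only [mem_inter]; tauto]
    have hup := ptVal_kapA_le_uForm hQ (isUpperSet_secR hB x) (isUpperSet_secR hA x)
    unfold uForm at hup
    have e1 : Q ∩ secR B x ∩ secR A x = Q ∩ secR A x ∩ secR B x := by ext y; simp only [mem_inter]; tauto
    have e2 : refl Q ∩ secR B x ∩ secR A x = refl Q ∩ secR A x ∩ secR B x := by ext y; simp only [mem_inter]; tauto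
    rw [e1, e2] at hup
    linarith
  -- Kleitman across the first block: `Σ_{x∈refl P₁} #(rQ∩A_x∩B_x) ≤ Σ_{x∈P₁} #(rQ∩A_x∩B_x)`
  have hkl : ∑ x ∈ refl P₁, ((refl Q ∩ secR A x ∩ secR B x).card : ℤ) ≤ ∑ x ∈ P₁, ((refl Q ∩ secR A x ∩ secR B x).card : ℤ) := by
    -- both sides are `Σ_{y∈refl Q} #(· ∩ C^y)` with `C = A ∩ B`, `C^y = secL C y` an up-set of the first block
    have hswap : ∀ R : Finset (Finset γ₁), ∑ x ∈ R, ((refl Q ∩ secR A x ∩ secR B x).card : ℤ)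
        = ∑ y ∈ refl Q, ((R ∩ secL (A ∩ B) y).card : ℤ) := by
      intro R
      have h1 : ∀ x : Finset γ₁, ((refl Q ∩ secR A x ∩ secR B x).card : ℤ) = ∑ y ∈ refl Q, (if x.disjSum y ∈ A ∩ B then (1 : ℤ) else 0) := by
        intro x
        rw [Finset.sum_boole, inter_assoc, ← filter_mem_eq_inter]
        congr 2; ext y; simp only [mem_filter, mem_inter, mem_secR]
      have h2 : ∀ y : Finset γ₂, ((R ∩ secL (A ∩ B) y).card : ℤ) = ∑ x ∈ R, (if x.disjSum y ∈ A ∩ B then (1 : ℤ) else 0) := by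
        intro y
        rw [Finset.sum_boole, ← filter_mem_eq_inter]
        congr 2; ext x; simp only [mem_filter, mem_secL]
      simp_rw [h1, h2]
      exact Finset.sum_comm
    rw [hswap, hswap]
    refine sum_le_sum fun y _ => ?_
    have hC : IsUpperSet ((A ∩ B : Finset (Finset (γ₁ ⊕ γ₂))) : Set (Finset (γ₁ ⊕ γ₂))) := by rw [coe_inter]; exact hA.inter hB
    have h := card_refl_inter_le (isUpperSet_secL hC y) h₁
    exact_mod_cast h
  have hsum := sum_le_sum fun x (_ : x ∈ P₁) => hfib x
  rw [sum_sub_distrib, ← mul_sum] at hsum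
  linarith

/-! ### The typed conjecture and the reduction -/

/-- **CONJECTURE (AND of an intersecting shell with a shell).**  For an antipode-free up-set `P₁` whose shell is a Kleitman shell and an up-set `Q` whose shell is a
Kleitman shell, the sectionwise Formula-A score satisfies the LOWER sandwich bound on `andProd P₁ Q`.  Proved for `P₁ = {univ}` (the cone theorem); exact numerical
evidence `maj₃∧OR₂`, `maj₃∧OR₃`, `maj₃∧(x∨yz)`, `maj₃∧maj₃`, all cones over shells on ≤ 4 coordinates; sharp in `P₁` (fails for `K₂₂`).  An obligation of our theory,
never a fact. [this work] -/
@[conjecture] def AndShellLower : Prop :=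
  ∀ (γ₁ γ₂ : Type) [DecidableEq γ₁] [Fintype γ₁] [DecidableEq γ₂] [Fintype γ₂] (P₁ : Finset (Finset γ₁)) (Q : Finset (Finset γ₂)),
    IsUpperSet (P₁ : Set (Finset γ₁)) → Disjoint P₁ (refl P₁) → KlShell (P₁ ∪ refl P₁) →
    IsUpperSet (Q : Set (Finset γ₂)) → KlShell (Q ∪ refl Q) →
    ∀ A B : Finset (Finset (γ₁ ⊕ γ₂)), IsUpperSet (A : Set (Finset (γ₁ ⊕ γ₂))) → IsUpperSet (B : Set (Finset (γ₁ ⊕ γ₂))) →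
      lForm (andProd P₁ Q) A B ≤ scoreVal (secFAScore P₁ Q) A B

/-- **`AndShellLower ⟹ TriWIneq` for every AND-product of an antipode-free shell family with a shell family** (all index cubes). [this work] -/
theorem triW_nonneg_andProd_of_andShellLower (hconj : AndShellLower) {P₁ : Finset (Finset γ₁)} {Q : Finset (Finset γ₂)}
    (h₁ : IsUpperSet (P₁ : Set (Finset γ₁))) (hd : Disjoint P₁ (refl P₁)) (hs₁ : KlShell (P₁ ∪ refl P₁))
    (hQ : IsUpperSet (Q : Set (Finset γ₂))) (hsQ : KlShell (Q ∪ refl Q))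
    (F G : Finset β → Finset (Finset (γ₁ ⊕ γ₂)))
    (hF : ∀ x, IsUpperSet (F x : Set (Finset (γ₁ ⊕ γ₂)))) (hG : ∀ x, IsUpperSet (G x : Set (Finset (γ₁ ⊕ γ₂))))
    (hFm : Monotone F) (hGm : Monotone G) :
    0 ≤ triW (andProd P₁ Q) F G := by
  refine triW_nonneg_of_scoreCert (monoScore_secFAScore P₁ Q) (fun A B hA hB => ⟨?_, ?_⟩) F G hF hG hFm hGm
  · exact hconj γ₁ γ₂ P₁ Q h₁ hd hs₁ hQ hsQ A B hA hB
  · exact scoreVal_secFAScore_le_uForm h₁ hQ hA hB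

end FiveUpSet

end Summit.CriticalPhenomena.PercolationContinuityZ3.Theorems
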